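/-
Copyright: the b2b-balaban cell (near-miss cell 7), T⁴-continuum CRUX team (coordinator ruling e34b3e0c item (2)),
seat t4-ne7b-formalise-leaf-06 (gen 28). Released under the licence of the surrounding project.
-/
import Summits.QuantumFields.BalabanUV.T4Continuum.Spine.NE7b.CovariantDivergenceEL

/-!
# PH-k (β₄), part B: the exact covariant lattice Weitzenböck identity and the mean-value inequality with an explicit
# `C′_d` (route NE7b R-H, `t4/ROUTES-NE7b.md` v5 §2 PH-k (β₄); PRICING-NE7b v5 F23c «(β₄) ACCEPT, M-small»)

Cell `pub-balaban`, sub-cell `t4`, spine estimate NE7b (node U5c), candidate route R-H «Peierls healing map», lemma PH-k.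
ROUTES-NE7b v5 §2 (β₄), verbatim: «MEAN-VALUE INEQUALITY: (β₁)–(β₃) with transports (each transport around a plaquette
costs `‖Ad(U_p) − 1‖ ≤ 2s_p`, applied to `O(m)` quantities) give at every `p ∈ I`
`|2d·E_p − Σ_{λ,±} 𝒯E_{p±e_λ}| ≤ C′_d·m_p²`, hence `2d·s_p ≤ Σ_{λ = 1..d, ±} s_{p±e_λ} + C′_d·m_p²` … [NEW-local, M-small:
the bookkeeping of `C′_d = (Bianchi) 2(d−2)C_B + (transport) O(d)` is the one place where work remains; ABELIAN CASE
`C′_d = 0` EXACTLY = v4 (2b)'s componentwise harmonicity]». The refuter (PRICING-NE7b v5 F23c): «(β₄) ACCEPT [NEW-local,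
M-small]: the ORDER claim (no first-order excess) is FORCED … what remains is the constant `C′_d` … bookkeeping».

THIS FILE DOES THE BOOKKEEPING IN THE KERNEL, for `G =` unit quaternions (`Metric.sphere (0 : ℍ) 1`), any `d`, any
configuration `U : ZdGaugeConfig d G`, at the plaquette `p = (x; i, j)`, with the objects of part A
(`CovariantDivergenceEL`: `curv` = `E`, `Ad` = transport, `covDiv` = covariant divergence, `covDivSummand`).

* §1 `cubeFaces`, **`bianchiSum`** (the first-order Bianchi sum of the cube `(x; i,j,k)`: the signed, transported face
  `E`'s, = the sum of `Im`'s of the six factors of `QuaternionBianchiDefect.ZdGaugeConfig.bianchi_cube`, whose ordered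
  product is EXACTLY `1`) and `norm_bianchiSum_le` (`≤ 114 m²`, from `bianchi_defect_cube`).
* §2 **`mismatch`**: the two far side faces of the LOWER cube `(x−e_k; i,j,k)` are read by the Euler–Lagrange equations
  along `x → x+e_j → x+e_j−e_k` but by the lower Bianchi identity along `x → x−e_k → x−e_k+e_j` (and the same with `i`
  for `j`); the two transports differ by the transported plaquette `P_{jk}(x−e_k)` (resp. `P_{ik}(x−e_k)`):
  `lowerPath_eq` and **`norm_mismatch_le`** (`≤ 4 m²`). The UPPER cube's side faces are read IDENTICALLY by both — no
  mismatch there. `defect := bianchiSum(x) − Ad(U(x−e_k,k))⁻¹ bianchiSum(x−e_k) − mismatch`, `‖defect‖ ≤ 232 m²`.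
* §3 **THE EXACT COVARIANT WEITZENBÖCK IDENTITY** (`weitzenbock_identity`, no hypothesis at all):
  `Div(x,i) − Ad U(x,j)·Div(x+e_j,i) − Div(x,j) + Ad U(x,i)·Div(x+e_i,j) = covLaplacian U x i j − Σ_k defect_k`,
  where `covLaplacian U x i j := Σ_k [2E_p − Ad U(x,k)·E_{ij}(x+e_k) − Ad U(x−e_k,k)⁻¹·E_{ij}(x−e_k)]` is (minus) the
  covariant lattice Laplacian of `E` at `p` (all `2d` neighbours transported to `x`), proved summand by summand
  (`summand_identity`, pure transport algebra); the degenerate defects `k = i`, `k = j` vanish (`defect_left∕right`).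
  This is the lattice `−Δ_A F = (d_A δ_A + δ_A d_A) F` with both Bianchi and its defect kept exact.
* §4 **(β₄)**: at a plaquette whose four links satisfy the lattice Yang–Mills equation (`covDiv = 0`; equivalently
  criticality of the Wilson action in those links, part A `critical_iff_covDiv_eq_zero`) and whose `2(d−2)` upper and
  lower cubes have faces with `Re ≥ 0` and sine-curvature `≤ m ≤ ½`:
  **`norm_covLaplacian_le`** — `‖covLaplacian U x i j‖ ≤ 232·(d−2)·m²`, and the scalar MEAN-VALUE INEQUALITY
  **`meanValue_inequality`** — `2d·‖E_p‖ ≤ Σ_k (‖E_{ij}(x+e_k)‖ + ‖E_{ij}(x−e_k)‖) + 232·(d−2)·m²`.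
  So `C′_d ≤ 232(d−2) = (d−2)(2·C_B + 4)` with `C_B = 114` (crude: v5's numerics see `≲ 0.15`); `d = 4`: `464`.

HONEST FRAMING. Law-free kernel algebra about ONE lattice configuration (no measure, no effective action); the constant
is crude and only the `m ≤ ½` regime is treated; nothing of (MP<L²)'s envelope∕window∕look-in certification (ROUTES v5
(δ), PRICING v5 F23∕F23a∕F23b), nothing of [Bałaban 1983–89] asserted or cited; the `specialUnitaryGroup (Fin 2) ℂ ≃`
unit-quaternion bridge is NOT formalised. NE7b (`T4WeightBudget.RelWeightBound`) NOT PRINTED, NOT PROVED; spine PROVED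
0∕9; rung (B)+1 on a FINITE torus T⁴ — NOT infinite volume, NOT the mass gap, NOT Clay. HONEST DEPENDENCY: continuum YM
on T⁴ ⇐ BetaPertH ∧ nine spine estimates (0/9 proved); BetaPertH ⇐ (D1) ∧ (D4) ∧ CAP+tail; G-an2-4 gates asym, D1 and
NE2/3/4. POLICY: crux-route work under `Spine/NE7b/` (FREEZE (0) respected: ROUTES v5's named item (β₄), not a
`T4Continuum/Support` leaf, not a folklore-algebra module); concrete `ℍ`∕`List`-valued definitions only, no `Prop` fact,
no `[cite:]` fact.
-/

set_option autoImplicit false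

namespace Summit.QuantumFields.BalabanUV.T4Continuum.NE7b.CovariantMeanValueInequality

noncomputable section

open Quaternion
open scoped Quaternion
open Literature.MathematicalPhysics.QuantumFieldTheory (ZdEdge ZdGaugeConfig)
open Literature.Probability.LatticeModels (Site)
open Summit.QuantumFields.BalabanUV.T4Continuum.NE7b.QuaternionBianchiDefect
  (norm_coe_sphere coe_inv_eq_star im_coe_inv norm_im_coe_conj bianchi_defect_cube)
open Summit.QuantumFields.BalabanUV.T4Continuum.NE7b.CovariantDivergenceEL

variable {d : ℕ}

/-! ## §1 The first-order Bianchi sum of a cube -/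

/-- The six faces of the 3-cube at `x` in directions `i, j, k`, in the order of
`QuaternionBianchiDefect.bianchi_defect_cube`'s hypotheses: `P_{ij}(x), P_{ik}(x+e_j), P_{jk}(x), P_{ij}(x+e_k),
P_{ik}(x), P_{jk}(x+e_i)`. -/
def cubeFaces (U : ZdGaugeConfig d (Metric.sphere (0 : ℍ) 1)) (x : Site d) (i j k : Fin d) :
    List (Metric.sphere (0 : ℍ) 1) :=
  [ZdGaugeConfig.plaquette U x i j, ZdGaugeConfig.plaquette U (x + Pi.single j 1) i k,
    ZdGaugeConfig.plaquette U x j k, ZdGaugeConfig.plaquette U (x + Pi.single k 1) i j,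
    ZdGaugeConfig.plaquette U x i k, ZdGaugeConfig.plaquette U (x + Pi.single i 1) j k]

/-- **The first-order Bianchi sum** of the cube `(x; i, j, k)`: the signed sum of the six face sine-curvatures, the three
far faces transported to `x` along one edge — the sum of the imaginary parts of the six factors of the cube word of
`ZdGaugeConfig.bianchi_cube` (whose ordered product is exactly `1`). -/
def bianchiSum (U : ZdGaugeConfig d (Metric.sphere (0 : ℍ) 1)) (x : Site d) (i j k : Fin d) : ℍ :=
  curv U x i j + Ad (U (x, j)) (curv U (x + Pi.single j 1) i k) + curv U x j k
    - Ad (U (x, k)) (curv U (x + Pi.single k 1) i j) - curv U x i k - Ad (U (x, i)) (curv U (x + Pi.single i 1) j k)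

/-- `bianchiSum` IS the sum of `Im`'s of `bianchi_cube`'s six factors. -/
theorem bianchiSum_eq (U : ZdGaugeConfig d (Metric.sphere (0 : ℍ) 1)) (x : Site d) (i j k : Fin d) :
    bianchiSum U x i j k =
      (([ZdGaugeConfig.plaquette U x i j,
          U (x, j) * ZdGaugeConfig.plaquette U (x + Pi.single j 1) i k * (U (x, j))⁻¹,
          ZdGaugeConfig.plaquette U x j k,
          (U (x, k) * ZdGaugeConfig.plaquette U (x + Pi.single k 1) i j * (U (x, k))⁻¹)⁻¹,
          (ZdGaugeConfig.plaquette U x i k)⁻¹,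
          (U (x, i) * ZdGaugeConfig.plaquette U (x + Pi.single i 1) j k * (U (x, i))⁻¹)⁻¹] :
            List (Metric.sphere (0 : ℍ) 1)).map fun q => ((q : (Metric.sphere (0 : ℍ) 1)) : ℍ).im).sum := by
  simp only [List.map, List.sum_cons, List.sum_nil, add_zero, im_coe_inv, coe_conj, im_Ad, bianchiSum, curv]
  abel

/-- **`‖bianchiSum‖ ≤ 114·m²`** when the six faces have `Re ≥ 0` and sine-curvature `≤ m ≤ ½` ((β₂), g27's
`bianchi_defect_cube`). -/
theorem norm_bianchiSum_le (U : ZdGaugeConfig d (Metric.sphere (0 : ℍ) 1)) (x : Site d) (i j k : Fin d) {m : ℝ}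
    (hm : 0 ≤ m) (hm2 : m ≤ 1 / 2) (hre : ∀ q ∈ cubeFaces U x i j k, 0 ≤ (q : ℍ).re)
    (him : ∀ q ∈ cubeFaces U x i j k, ‖(q : ℍ).im‖ ≤ m) : ‖bianchiSum U x i j k‖ ≤ 114 * m ^ 2 := by
  rw [bianchiSum_eq]
  exact bianchi_defect_cube U x i j k hm hm2 hre him

/-! ## §2 The transport mismatch of the lower cube and the total defect -/

/-- **The transport mismatch** of the lower cube `(x−e_k; i, j, k)` seen from the plaquette `(x; i, j)`: its two far
side faces `P_{ik}(x−e_k+e_j)` and `P_{jk}(x−e_k+e_i)` are transported to `x` along `x → x+e_j → x+e_j−e_k` (resp.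
`x → x+e_i → …`) by the Euler–Lagrange equations at the links `(x+e_j, i)`, `(x+e_i, j)`, but along `x → x−e_k → x−e_k+e_j`
(resp. `… + e_i`) by the lower Bianchi identity; `mismatch` is the difference of the two readings. -/
def mismatch (U : ZdGaugeConfig d (Metric.sphere (0 : ℍ) 1)) (x : Site d) (i j k : Fin d) : ℍ :=
  (Ad (U (x, j) * (U (x - Pi.single k 1 + Pi.single j 1, k))⁻¹) (curv U (x - Pi.single k 1 + Pi.single j 1) i k)
      - Ad ((U (x - Pi.single k 1, k))⁻¹ * U (x - Pi.single k 1, j)) (curv U (x - Pi.single k 1 + Pi.single j 1) i k))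
    - (Ad (U (x, i) * (U (x - Pi.single k 1 + Pi.single i 1, k))⁻¹) (curv U (x - Pi.single k 1 + Pi.single i 1) j k)
      - Ad ((U (x - Pi.single k 1, k))⁻¹ * U (x - Pi.single k 1, i)) (curv U (x - Pi.single k 1 + Pi.single i 1) j k))

/-- The two paths from `x` to `x−e_k+e_j` differ by a plaquette: with `y = x − e_k`,
`U(y,k)⁻¹·U(y,j) = [U(y,k)⁻¹ · P_{jk}(y) · U(y,k)] · [U(x,j) · U(y+e_j,k)⁻¹]` (any group). -/
theorem lowerPath_eq {G : Type*} [Group G] (U : ZdGaugeConfig d G) (x : Site d) (j k : Fin d) :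
    (U (x - Pi.single k 1, k))⁻¹ * U (x - Pi.single k 1, j) =
      ((U (x - Pi.single k 1, k))⁻¹ * ZdGaugeConfig.plaquette U (x - Pi.single k 1) j k *
          ((U (x - Pi.single k 1, k))⁻¹)⁻¹) *
        (U (x, j) * (U (x - Pi.single k 1 + Pi.single j 1, k))⁻¹) := by
  have h : x - Pi.single k 1 + Pi.single k 1 = x := sub_add_cancel _ _
  simp only [ZdGaugeConfig.plaquette, h, inv_inv, mul_assoc, inv_mul_cancel_left, mul_inv_cancel, mul_one]

/-- **`‖mismatch‖ ≤ 4·m²`**: each of the two readings differs by a transport around ONE lower-cube face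
(`norm_Ad_sub_Ad_le`: cost `≤ 2·‖Im P‖ ≤ 2m`) applied to a side-face sine-curvature of norm `≤ m`. -/
theorem norm_mismatch_le (U : ZdGaugeConfig d (Metric.sphere (0 : ℍ) 1)) (x : Site d) (i j k : Fin d) {m : ℝ}
    (hm : 0 ≤ m)
    (hPjk : ‖((ZdGaugeConfig.plaquette U (x - Pi.single k 1) j k : (Metric.sphere (0 : ℍ) 1)) : ℍ).im‖ ≤ m)
    (hPik : ‖((ZdGaugeConfig.plaquette U (x - Pi.single k 1) i k : (Metric.sphere (0 : ℍ) 1)) : ℍ).im‖ ≤ m)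
    (hEik : ‖curv U (x - Pi.single k 1 + Pi.single j 1) i k‖ ≤ m)
    (hEjk : ‖curv U (x - Pi.single k 1 + Pi.single i 1) j k‖ ≤ m) : ‖mismatch U x i j k‖ ≤ 4 * m ^ 2 := by
  have h1 := norm_Ad_sub_Ad_le _ _ _ (lowerPath_eq U x j k) (curv U (x - Pi.single k 1 + Pi.single j 1) i k)
  have h2 := norm_Ad_sub_Ad_le _ _ _ (lowerPath_eq U x i k) (curv U (x - Pi.single k 1 + Pi.single i 1) j k)
  rw [Metric.unitSphere.coe_mul, Metric.unitSphere.coe_mul] at h1 h2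
  rw [← Metric.unitSphere.coe_mul, ← Metric.unitSphere.coe_mul, norm_im_coe_conj] at h1 h2
  rw [norm_sub_rev] at h1 h2
  calc ‖mismatch U x i j k‖ ≤ _ := norm_sub_le _ _
    _ ≤ 2 * m * m + 2 * m * m := by
        refine add_le_add (h1.trans ?_) (h2.trans ?_)
        · exact mul_le_mul (by linarith) hEik (norm_nonneg _) (by positivity)
        · exact mul_le_mul (by linarith) hEjk (norm_nonneg _) (by positivity)
    _ = 4 * m ^ 2 := by ring

/-- **The total second-order defect** attached to the transverse direction `k` at the plaquette `(x; i, j)`: the upper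
cube's Bianchi sum, minus the lower cube's Bianchi sum transported to `x` along `(x−e_k, k)`, minus the transport
mismatch. -/
def defect (U : ZdGaugeConfig d (Metric.sphere (0 : ℍ) 1)) (x : Site d) (i j k : Fin d) : ℍ :=
  bianchiSum U x i j k - Ad (U (x - Pi.single k 1, k))⁻¹ (bianchiSum U (x - Pi.single k 1) i j k) - mismatch U x i j k

/-- **`‖defect‖ ≤ 232·m²`** (`114 + 114 + 4`) when the faces of the upper and lower cubes have `Re ≥ 0` and
sine-curvature `≤ m ≤ ½`. -/
theorem norm_defect_le (U : ZdGaugeConfig d (Metric.sphere (0 : ℍ) 1)) (x : Site d) (i j k : Fin d) {m : ℝ}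
    (hm : 0 ≤ m) (hm2 : m ≤ 1 / 2)
    (hre : ∀ q ∈ cubeFaces U x i j k ++ cubeFaces U (x - Pi.single k 1) i j k, 0 ≤ (q : ℍ).re)
    (him : ∀ q ∈ cubeFaces U x i j k ++ cubeFaces U (x - Pi.single k 1) i j k, ‖(q : ℍ).im‖ ≤ m) :
    ‖defect U x i j k‖ ≤ 232 * m ^ 2 := by
  have hup : ‖bianchiSum U x i j k‖ ≤ 114 * m ^ 2 :=
    norm_bianchiSum_le U x i j k hm hm2 (fun q hq => hre q (List.mem_append_left _ hq))
      (fun q hq => him q (List.mem_append_left _ hq))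
  have hdown : ‖Ad (U (x - Pi.single k 1, k))⁻¹ (bianchiSum U (x - Pi.single k 1) i j k)‖ ≤ 114 * m ^ 2 := by
    rw [norm_Ad]
    exact norm_bianchiSum_le U _ i j k hm hm2 (fun q hq => hre q (List.mem_append_right _ hq))
      (fun q hq => him q (List.mem_append_right _ hq))
  have hlow : ∀ q ∈ cubeFaces U (x - Pi.single k 1) i j k, ‖(q : ℍ).im‖ ≤ m :=
    fun q hq => him q (List.mem_append_right _ hq)
  have hmis : ‖mismatch U x i j k‖ ≤ 4 * m ^ 2 :=
    norm_mismatch_le U x i j k hm (hlow _ (by simp [cubeFaces])) (hlow _ (by simp [cubeFaces]))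
      (hlow _ (by simp [cubeFaces])) (hlow _ (by simp [cubeFaces]))
  calc ‖defect U x i j k‖ ≤ ‖bianchiSum U x i j k - Ad (U (x - Pi.single k 1, k))⁻¹ (bianchiSum U (x - Pi.single k 1) i j k)‖
        + ‖mismatch U x i j k‖ := norm_sub_le _ _
    _ ≤ (114 * m ^ 2 + 114 * m ^ 2) + 4 * m ^ 2 := add_le_add ((norm_sub_le _ _).trans (add_le_add hup hdown)) hmis
    _ = 232 * m ^ 2 := by ring

/-! ## §3 The exact covariant Weitzenböck identity -/

/-- (Minus) **the covariant lattice Laplacian of `E` at the plaquette `(x; i, j)`**: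
`Σ_k [2·E_{ij}(x) − Ad U(x,k)·E_{ij}(x+e_k) − Ad U(x−e_k,k)⁻¹·E_{ij}(x−e_k)]` — all `2d` lattice neighbours of the
plaquette (the four in-plane ones sharing a link, the `2(d−2)` transverse translates across a cube), each transported to
`x` along the link joining the base points. -/
def covLaplacian (U : ZdGaugeConfig d (Metric.sphere (0 : ℍ) 1)) (x : Site d) (i j : Fin d) : ℍ :=
  ∑ k : Fin d, (2 • curv U x i j - Ad (U (x, k)) (curv U (x + Pi.single k 1) i j)
    - Ad (U (x - Pi.single k 1, k))⁻¹ (curv U (x - Pi.single k 1) i j))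

/-- **THE SUMMAND IDENTITY** (pure transport algebra, every `k`): the `k`-th summands of
`Div(x,i) − Ad U(x,j)·Div(x+e_j,i) − Div(x,j) + Ad U(x,i)·Div(x+e_i,j)` combine to the `k`-th summand of the covariant
Laplacian minus `defect_k`. -/
theorem summand_identity (U : ZdGaugeConfig d (Metric.sphere (0 : ℍ) 1)) (x : Site d) (i j k : Fin d) :
    covDivSummand U x i k - Ad (U (x, j)) (covDivSummand U (x + Pi.single j 1) i k) - covDivSummand U x j k
        + Ad (U (x, i)) (covDivSummand U (x + Pi.single i 1) j k) =
      (2 • curv U x i j - Ad (U (x, k)) (curv U (x + Pi.single k 1) i j)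
          - Ad (U (x - Pi.single k 1, k))⁻¹ (curv U (x - Pi.single k 1) i j)) - defect U x i j k := by
  have h1 : x + Pi.single j 1 - Pi.single k 1 = x - Pi.single k 1 + Pi.single j 1 := add_sub_right_comm _ _ _
  have h2 : x + Pi.single i 1 - Pi.single k 1 = x - Pi.single k 1 + Pi.single i 1 := add_sub_right_comm _ _ _
  have h3 : x - Pi.single k 1 + Pi.single k 1 = x := sub_add_cancel _ _
  simp only [defect, mismatch, bianchiSum, covDivSummand, h1, h2, h3, map_sub, map_add, ← Ad_mul, inv_mul_cancel, Ad_one]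
  abel

/-- **THE EXACT COVARIANT LATTICE WEITZENBÖCK IDENTITY** (no hypothesis): for every unit-quaternion configuration,
every `x` and directions `i, j`,
`Div(x,i) − Ad U(x,j)·Div(x+e_j,i) − Div(x,j) + Ad U(x,i)·Div(x+e_i,j) = covLaplacian U x i j − Σ_k defect_k` —
the lattice form of `(d_A δ_A + δ_A d_A)F = −Δ_A F` with the Bianchi identity and its second-order defect kept exact. -/
theorem weitzenbock_identity (U : ZdGaugeConfig d (Metric.sphere (0 : ℍ) 1)) (x : Site d) (i j : Fin d) :
    covDiv U x i - Ad (U (x, j)) (covDiv U (x + Pi.single j 1) i) - covDiv U x j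
        + Ad (U (x, i)) (covDiv U (x + Pi.single i 1) j) =
      covLaplacian U x i j - ∑ k : Fin d, defect U x i j k := by
  rw [covDiv, covDiv, covDiv, covDiv, covLaplacian, map_sum, map_sum, ← Finset.sum_sub_distrib,
    ← Finset.sum_sub_distrib, ← Finset.sum_add_distrib, ← Finset.sum_sub_distrib]
  exact Finset.sum_congr rfl fun k _ => summand_identity U x i j k

/-- The degenerate defect `k = i` vanishes. -/
theorem defect_left (U : ZdGaugeConfig d (Metric.sphere (0 : ℍ) 1)) (x : Site d) (i j : Fin d) :
    defect U x i j i = 0 := by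
  have h3 : x - Pi.single i 1 + Pi.single i 1 = x := sub_add_cancel _ _
  simp only [defect, mismatch, bianchiSum, h3, curv_self, curv_swap U _ j i, map_zero, map_neg, map_sub, map_add,
    ← Ad_mul, mul_inv_cancel, inv_mul_cancel, Ad_one]
  abel

/-- The degenerate defect `k = j` vanishes. -/
theorem defect_right (U : ZdGaugeConfig d (Metric.sphere (0 : ℍ) 1)) (x : Site d) (i j : Fin d) :
    defect U x i j j = 0 := by
  have h3 : x - Pi.single j 1 + Pi.single j 1 = x := sub_add_cancel _ _
  simp only [defect, mismatch, bianchiSum, h3, curv_self, curv_swap U _ j i, map_zero, map_neg, map_sub, map_add,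
    ← Ad_mul, mul_inv_cancel, inv_mul_cancel, Ad_one]
  abel

/-- Two distinct directions need `d ≥ 2`. -/
theorem two_le_of_ne (i j : Fin d) (hij : i ≠ j) : 2 ≤ d := by
  have h : 1 < (Finset.univ : Finset (Fin d)).card := Finset.one_lt_card.2 ⟨i, Finset.mem_univ _, j, Finset.mem_univ _, hij⟩
  rwa [Finset.card_univ, Fintype.card_fin] at h

/-- The transverse directions at the plaquette `(x; i, j)`. -/
theorem card_transverse (i j : Fin d) (hij : i ≠ j) :
    (Finset.univ.filter fun k : Fin d => k ≠ i ∧ k ≠ j).card = d - 2 := by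
  have h : (Finset.univ.filter fun k : Fin d => k ≠ i ∧ k ≠ j) = Finset.univ \ {i, j} := by
    ext k; simp [not_or]
  rw [h, Finset.card_sdiff_of_subset (Finset.subset_univ _), Finset.card_univ, Fintype.card_fin, Finset.card_pair hij]

/-- Only the transverse defects contribute: `Σ_k defect_k = Σ_{k ≠ i, j} defect_k`. -/
theorem sum_defect_eq (U : ZdGaugeConfig d (Metric.sphere (0 : ℍ) 1)) (x : Site d) (i j : Fin d) :
    ∑ k : Fin d, defect U x i j k = ∑ k ∈ Finset.univ.filter (fun k : Fin d => k ≠ i ∧ k ≠ j), defect U x i j k := by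
  rw [Finset.sum_filter]
  refine Finset.sum_congr rfl fun k _ => ?_
  by_cases hki : k = i
  · subst hki; simp [defect_left]
  · by_cases hkj : k = j
    · subst hkj; simp [defect_right]
    · simp [hki, hkj]

/-! ## §4 (β₄): the covariant mean-value inequality -/

/-- **(β₄) — THE COVARIANT LAPLACIAN OF `E` AT A CRITICAL PLAQUETTE IS SECOND ORDER.** Let `U` be a unit-quaternion
configuration on `ℤ^d`, `p = (x; i, j)` a plaquette (`i ≠ j`) whose four links satisfy the lattice Yang–Mills equation
(`covDiv = 0` at `(x,i)`, `(x,j)`, `(x+e_j,i)`, `(x+e_i,j)` — by part A's `critical_iff_covDiv_eq_zero` this is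
criticality of the Wilson action in these links), and suppose the faces of the `2(d−2)` cubes above and below `p` in
every transverse direction have `Re ≥ 0` and sine-curvature `≤ m ≤ ½`. Then
`‖Σ_k [2E_p − Ad U(x,k)·E_{ij}(x+e_k) − Ad U(x−e_k,k)⁻¹·E_{ij}(x−e_k)]‖ ≤ 232·(d−2)·m²`. -/
theorem norm_covLaplacian_le (U : ZdGaugeConfig d (Metric.sphere (0 : ℍ) 1)) (x : Site d) (i j : Fin d) (hij : i ≠ j)
    {m : ℝ} (hm : 0 ≤ m) (hm2 : m ≤ 1 / 2)
    (hre : ∀ k : Fin d, k ≠ i → k ≠ j →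
      ∀ q ∈ cubeFaces U x i j k ++ cubeFaces U (x - Pi.single k 1) i j k, 0 ≤ (q : ℍ).re)
    (him : ∀ k : Fin d, k ≠ i → k ≠ j →
      ∀ q ∈ cubeFaces U x i j k ++ cubeFaces U (x - Pi.single k 1) i j k, ‖(q : ℍ).im‖ ≤ m)
    (hxi : covDiv U x i = 0) (hxj : covDiv U x j = 0) (hji : covDiv U (x + Pi.single j 1) i = 0)
    (hij' : covDiv U (x + Pi.single i 1) j = 0) :
    ‖covLaplacian U x i j‖ ≤ 232 * ((d : ℝ) - 2) * m ^ 2 := by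
  have hid := weitzenbock_identity U x i j
  rw [hxi, hxj, hji, hij', map_zero, map_zero, sub_zero, sub_zero, zero_add, eq_comm, sub_eq_zero, sum_defect_eq] at hid
  rw [hid]
  have hd : 2 ≤ d := two_le_of_ne i j hij
  calc ‖∑ k ∈ Finset.univ.filter (fun k : Fin d => k ≠ i ∧ k ≠ j), defect U x i j k‖
      ≤ ∑ k ∈ Finset.univ.filter (fun k : Fin d => k ≠ i ∧ k ≠ j), ‖defect U x i j k‖ := norm_sum_le _ _
    _ ≤ ∑ k ∈ Finset.univ.filter (fun k : Fin d => k ≠ i ∧ k ≠ j), 232 * m ^ 2 := by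
        refine Finset.sum_le_sum fun k hk => ?_
        rw [Finset.mem_filter] at hk
        exact norm_defect_le U x i j k hm hm2 (hre k hk.2.1 hk.2.2) (him k hk.2.1 hk.2.2)
    _ = 232 * ((d : ℝ) - 2) * m ^ 2 := by
        rw [Finset.sum_const, card_transverse i j hij, nsmul_eq_mul, Nat.cast_sub hd]
        push_cast
        ring

/-- **(β₄) — THE COVARIANT MEAN-VALUE INEQUALITY** (ROUTES-NE7b v5 §2 PH-k (β₄), with an explicit crude constant).
Under the hypotheses of `norm_covLaplacian_le`:
`2d·‖E_p‖ ≤ Σ_k (‖E_{ij}(x+e_k)‖ + ‖E_{ij}(x−e_k)‖) + 232·(d−2)·m²` — the sine-curvature of a plaquette whose links are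
critical is at most the AVERAGE of its `2d` neighbours' sine-curvatures plus a SECOND-ORDER defect (transports are
isometries). ABELIAN CASE: defect `0`, `AbelianCurvatureMaximumPrinciple`'s harmonicity; feeding this into
`LatticeSubsolutionBarrier.barrier_subsolution_le` ((γ), `κ := 232(d−2)m²`) is PH-k's approximate maximum principle. -/
theorem meanValue_inequality (U : ZdGaugeConfig d (Metric.sphere (0 : ℍ) 1)) (x : Site d) (i j : Fin d) (hij : i ≠ j)
    {m : ℝ} (hm : 0 ≤ m) (hm2 : m ≤ 1 / 2)
    (hre : ∀ k : Fin d, k ≠ i → k ≠ j →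
      ∀ q ∈ cubeFaces U x i j k ++ cubeFaces U (x - Pi.single k 1) i j k, 0 ≤ (q : ℍ).re)
    (him : ∀ k : Fin d, k ≠ i → k ≠ j →
      ∀ q ∈ cubeFaces U x i j k ++ cubeFaces U (x - Pi.single k 1) i j k, ‖(q : ℍ).im‖ ≤ m)
    (hxi : covDiv U x i = 0) (hxj : covDiv U x j = 0) (hji : covDiv U (x + Pi.single j 1) i = 0)
    (hij' : covDiv U (x + Pi.single i 1) j = 0) :
    2 * (d : ℝ) * ‖curv U x i j‖ ≤
      (∑ k : Fin d, (‖curv U (x + Pi.single k 1) i j‖ + ‖curv U (x - Pi.single k 1) i j‖))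
        + 232 * ((d : ℝ) - 2) * m ^ 2 := by
  have h := norm_covLaplacian_le U x i j hij hm hm2 hre him hxi hxj hji hij'
  -- split the covariant Laplacian as `(2d)·E − Σ_k (transported neighbours)`
  set N : Fin d → ℍ := fun k =>
    Ad (U (x, k)) (curv U (x + Pi.single k 1) i j) + Ad (U (x - Pi.single k 1, k))⁻¹ (curv U (x - Pi.single k 1) i j)
    with hN
  have hsplit : covLaplacian U x i j = (2 * (d : ℝ)) • curv U x i j - ∑ k : Fin d, N k := by
    simp only [covLaplacian, sub_sub]
    rw [Finset.sum_sub_distrib, Finset.sum_const, Finset.card_univ, Fintype.card_fin, ← Nat.cast_smul_eq_nsmul ℝ d,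
      ← Nat.cast_smul_eq_nsmul ℝ 2, smul_smul, Nat.cast_ofNat, mul_comm (d : ℝ) 2]
  have hnorm2d : ‖(2 * (d : ℝ)) • curv U x i j‖ = 2 * (d : ℝ) * ‖curv U x i j‖ := by
    rw [norm_smul, Real.norm_of_nonneg (by positivity)]
  have hN_le : ‖∑ k : Fin d, N k‖ ≤
      ∑ k : Fin d, (‖curv U (x + Pi.single k 1) i j‖ + ‖curv U (x - Pi.single k 1) i j‖) := by
    refine (norm_sum_le _ _).trans (Finset.sum_le_sum fun k _ => ?_)
    exact (norm_add_le _ _).trans (by rw [norm_Ad, norm_Ad])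
  rw [hsplit] at h
  calc 2 * (d : ℝ) * ‖curv U x i j‖ = ‖(2 * (d : ℝ)) • curv U x i j‖ := hnorm2d.symm
    _ ≤ ‖(2 * (d : ℝ)) • curv U x i j - ∑ k : Fin d, N k‖ + ‖∑ k : Fin d, N k‖ := norm_le_norm_sub_add _ _
    _ ≤ 232 * ((d : ℝ) - 2) * m ^ 2
        + ∑ k : Fin d, (‖curv U (x + Pi.single k 1) i j‖ + ‖curv U (x - Pi.single k 1) i j‖) := add_le_add h hN_le
    _ = _ := add_comm _ _

end

end Summit.QuantumFields.BalabanUV.T4Continuum.NE7b.CovariantMeanValueInequality
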